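import Mathlib

/-!
# Route PhotonSphereChannels · crux `TameCensorship` (stmt-FinalStateConjecture-17431) · line `Sketch`, skeleton v5 ·
# stub `stub_windingBound`: a confined curve with quadratically bounded acceleration has bounded speed

Helper file (`--supports stmt-FinalStateConjecture-17431`) of line `Sketch` (lead c2, 2026-08-17), a brick of the
PANCAKE LAW (alternative route to clause (a) of K3, skeleton v5): the analytic core of the ESCAPE LEMMA (a maximal
geodesic with a putative future endpoint `p` eventually stays in a small coordinate ball around `p`, where the geodesic
equation reads `x'' = −Γ(x)(x', x')`, `‖x''‖ ≤ K ‖x'‖²`; the present bound confines its tangent lift to a compact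
set, which is impossible for a maximal geodesic with bounded parameter domain). Pure real analysis in an inner
product space, no Lorentzian vocabulary.

References: P. Hartman, *Ordinary Differential Equations* (1964), Ch. III; B. O'Neill, *Semi-Riemannian Geometry*
(1983), Ch. 3 (geodesic equations in a chart).
-/

set_option linter.dupNamespace false

open Set Filter Real RealInnerProductSpace

noncomputable section

namespace Summit.FinalStateConjecture.FinalStateConjecture.Theorems.PhotonSphereChannels.TameCensorshipUnwind

/-- Scalar core of the winding bound: with `u = ‖v‖ > 0`, `A = ⟪x - p, a⟫`, `B = ⟪x - p, v⟫`,
`C = ⟪v, a⟫` bounded by Cauchy–Schwarz, `‖x - p‖ ≤ ρ` and `‖a‖ ≤ K u²`, the derivative of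
`ψ = log u - 2K · B/u` is non-positive as soon as `4Kρ ≤ 1`. -/
private lemma windingBound_scalar {A B C u ρ K : ℝ} (hu : 0 < u) (hK : 0 ≤ K) (hρ : 0 ≤ ρ)
    (hKρ : 4 * K * ρ ≤ 1) (hA : |A| ≤ ρ * (K * u ^ 2)) (hB : |B| ≤ ρ * u)
    (hC : |C| ≤ u * (K * u ^ 2)) :
    C / u / u - 2 * K * ((A + u ^ 2) * u⁻¹ + B * (-(C / u) / u ^ 2)) ≤ 0 := by
  have hu3 : 0 < u ^ 3 := by positivity
  have h1 : C * u ≤ K * u ^ 4 := by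
    calc C * u ≤ |C| * u := mul_le_mul_of_nonneg_right (le_abs_self C) hu.le
      _ ≤ u * (K * u ^ 2) * u := mul_le_mul_of_nonneg_right hC hu.le
      _ = K * u ^ 4 := by ring
  have h2 : 2 * K * (B * C) ≤ 2 * K * (ρ * K * u ^ 4) := by
    refine mul_le_mul_of_nonneg_left ?_ (by positivity)
    calc B * C ≤ |B * C| := le_abs_self _
      _ = |B| * |C| := abs_mul B C
      _ ≤ ρ * u * (u * (K * u ^ 2)) := mul_le_mul hB hC (abs_nonneg _) (by positivity)
      _ = ρ * K * u ^ 4 := by ring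
  have h3 : 2 * K * (-(ρ * K * u ^ 4)) ≤ 2 * K * (A * u ^ 2) := by
    refine mul_le_mul_of_nonneg_left ?_ (by positivity)
    have hA' : -(ρ * (K * u ^ 2)) ≤ A := by linarith [neg_abs_le A]
    calc -(ρ * K * u ^ 4) = -(ρ * (K * u ^ 2)) * u ^ 2 := by ring
      _ ≤ A * u ^ 2 := mul_le_mul_of_nonneg_right hA' (by positivity)
  have h4 : 4 * K * ρ * (K * u ^ 4) ≤ 1 * (K * u ^ 4) :=
    mul_le_mul_of_nonneg_right hKρ (by positivity)
  have key : C * u + 2 * K * (B * C) - 2 * K * (A * u ^ 2) - 2 * K * u ^ 4 ≤ 0 := by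
    nlinarith [h1, h2, h3, h4]
  have hexpr : C / u / u - 2 * K * ((A + u ^ 2) * u⁻¹ + B * (-(C / u) / u ^ 2)) =
      (C * u + 2 * K * (B * C) - 2 * K * (A * u ^ 2) - 2 * K * u ^ 4) / u ^ 3 := by
    field_simp
    ring
  rw [hexpr]
  exact div_nonpos_of_nonpos_of_nonneg key hu3.le

/-- **Stub `stub_windingBound` of line `Sketch` (skeleton v5) for the crux `PhotonSphereChannels.TameCensorship`
(stmt-FinalStateConjecture-17431): THE WINDING BOUND.** Let `x` have derivative `v ≠ 0` and second derivative `a`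
on `[t₀, T)` with `‖a t‖ ≤ K ‖v t‖²`, and stay in the ball `‖x t − p‖ ≤ ρ` with `4 K ρ ≤ 1`. Then
`‖v t‖ ≤ ‖v t₀‖ exp (4 K ρ)` on `[t₀, T)`. Proof: `θ := v/‖v‖` has `‖θ'‖ ≤ 2 ‖a‖/‖v‖ ≤ 2K ‖v‖`;
`φ := ⟨x − p, θ⟩` has `|φ| ≤ ρ` and `φ' = ‖v‖ + ⟨x − p, θ'⟩ ≥ ‖v‖ (1 − 2Kρ) ≥ ‖v‖/2`; so
`ψ := log ‖v‖ − 2K φ` is non-increasing (`ψ' ≤ ‖a‖/‖v‖ − K ‖v‖ ≤ 0`), whence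
`log ‖v t‖ ≤ log ‖v t₀‖ + 2K (φ t − φ t₀) ≤ log ‖v t₀‖ + 4Kρ`. [folklore; Hartman 1964, Ch. III] -/
theorem stub_windingBound :
    ∀ (E : Type) [NormedAddCommGroup E] [InnerProductSpace ℝ E] (x v a : ℝ → E) (p : E) (K ρ t₀ T : ℝ),
    0 ≤ K → 0 ≤ ρ → 4 * K * ρ ≤ 1 → t₀ < T →
    (∀ t ∈ Set.Ico t₀ T, HasDerivAt x (v t) t) → (∀ t ∈ Set.Ico t₀ T, HasDerivAt v (a t) t) →
    (∀ t ∈ Set.Ico t₀ T, ‖a t‖ ≤ K * ‖v t‖ ^ 2) → (∀ t ∈ Set.Ico t₀ T, v t ≠ 0) →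
    (∀ t ∈ Set.Ico t₀ T, ‖x t - p‖ ≤ ρ) →
    ∀ t ∈ Set.Ico t₀ T, ‖v t‖ ≤ ‖v t₀‖ * Real.exp (4 * K * ρ) := by
  intro E _ _ x v a p K ρ t₀ T hK hρ hKρ _ hx hv ha hv0 hxp t ht
  -- the speed is positive and differentiable, `u' = ⟪v, a⟫ / u`
  have hpos : ∀ s ∈ Ico t₀ T, 0 < ‖v s‖ := fun s hs => norm_pos_iff.mpr (hv0 s hs)
  have hu : ∀ s ∈ Ico t₀ T, HasDerivAt (fun y => ‖v y‖) (⟪v s, a s⟫ / ‖v s‖) s := by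
    intro s hs
    have h1 : HasDerivAt (fun y => √(‖v y‖ ^ 2)) (2 * ⟪v s, a s⟫ / (2 * √(‖v s‖ ^ 2))) s :=
      (hv s hs).norm_sq.sqrt (pow_ne_zero 2 (hpos s hs).ne')
    have h2 : (fun y => √(‖v y‖ ^ 2)) = fun y => ‖v y‖ :=
      funext fun y => Real.sqrt_sq (norm_nonneg _)
    rw [h2, Real.sqrt_sq (norm_nonneg _), mul_div_mul_left _ _ (two_ne_zero' ℝ)] at h1
    exact h1
  -- the radial reading `φ = ⟪x - p, v/‖v‖⟫` of the direction and the Lyapunov function `ψ`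
  set φ : ℝ → ℝ := fun y => ⟪x y - p, v y⟫ * (‖v y‖)⁻¹ with hφ_def
  set ψ : ℝ → ℝ := fun y => Real.log ‖v y‖ - 2 * K * φ y with hψ_def
  set ψ' : ℝ → ℝ := fun s => ⟪v s, a s⟫ / ‖v s‖ / ‖v s‖ -
      2 * K * ((⟪x s - p, a s⟫ + ⟪v s, v s⟫) * (‖v s‖)⁻¹ +
        ⟪x s - p, v s⟫ * (-(⟪v s, a s⟫ / ‖v s‖) / ‖v s‖ ^ 2)) with hψ'_def
  have hψ : ∀ s ∈ Ico t₀ T, HasDerivAt ψ (ψ' s) s := by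
    intro s hs
    have hne : ‖v s‖ ≠ 0 := (hpos s hs).ne'
    have h1 : HasDerivAt (fun y => x y - p) (v s) s := (hx s hs).sub_const p
    have h2 : HasDerivAt (fun y => ⟪x y - p, v y⟫) (⟪x s - p, a s⟫ + ⟪v s, v s⟫) s :=
      h1.inner ℝ (hv s hs)
    have h3 : HasDerivAt (fun y => (‖v y‖)⁻¹) (-(⟪v s, a s⟫ / ‖v s‖) / ‖v s‖ ^ 2) s :=
      (hu s hs).inv hne
    have h4 : HasDerivAt φ ((⟪x s - p, a s⟫ + ⟪v s, v s⟫) * (‖v s‖)⁻¹ +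
        ⟪x s - p, v s⟫ * (-(⟪v s, a s⟫ / ‖v s‖) / ‖v s‖ ^ 2)) s := h2.mul h3
    have h5 : HasDerivAt (fun y => Real.log ‖v y‖) (⟪v s, a s⟫ / ‖v s‖ / ‖v s‖) s :=
      (hu s hs).log hne
    exact h5.sub (h4.const_mul (2 * K))
  -- `ψ' ≤ 0`
  have hψ'le : ∀ s ∈ Ico t₀ T, ψ' s ≤ 0 := by
    intro s hs
    simp only [hψ'_def, real_inner_self_eq_norm_sq]
    refine windingBound_scalar (hpos s hs) hK hρ hKρ ?_ ?_ ?_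
    · exact (abs_real_inner_le_norm _ _).trans
        (mul_le_mul (hxp s hs) (ha s hs) (norm_nonneg _) hρ)
    · exact (abs_real_inner_le_norm _ _).trans
        (mul_le_mul_of_nonneg_right (hxp s hs) (norm_nonneg _))
    · exact (abs_real_inner_le_norm _ _).trans
        (mul_le_mul_of_nonneg_left (ha s hs) (norm_nonneg _))
  -- `|φ| ≤ ρ`
  have hφle : ∀ s ∈ Ico t₀ T, |φ s| ≤ ρ := by
    intro s hs
    simp only [hφ_def]
    rw [abs_mul, abs_inv, abs_norm, ← div_eq_mul_inv, div_le_iff₀ (hpos s hs)]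
    exact (abs_real_inner_le_norm _ _).trans
      (mul_le_mul_of_nonneg_right (hxp s hs) (norm_nonneg _))
  -- `ψ` is antitone on `[t₀, t] ⊆ [t₀, T)`
  have hsub : Icc t₀ t ⊆ Ico t₀ T := fun s hs => ⟨hs.1, hs.2.trans_lt ht.2⟩
  have hanti : AntitoneOn ψ (Icc t₀ t) := by
    refine antitoneOn_of_hasDerivWithinAt_nonpos (f' := ψ') (convex_Icc t₀ t)
      (fun s hs => (hψ s (hsub hs)).continuousAt.continuousWithinAt) ?_ ?_
    · intro s hs
      rw [interior_Icc] at hs ⊢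
      exact (hψ s (hsub (Ioo_subset_Icc_self hs))).hasDerivWithinAt
    · intro s hs
      rw [interior_Icc] at hs
      exact hψ'le s (hsub (Ioo_subset_Icc_self hs))
  have ht₀ : t₀ ∈ Ico t₀ T := ⟨le_rfl, ht.1.trans_lt ht.2⟩
  have hmono : Real.log ‖v t‖ - 2 * K * φ t ≤ Real.log ‖v t₀‖ - 2 * K * φ t₀ :=
    hanti (left_mem_Icc.2 ht.1) (right_mem_Icc.2 ht.1) ht.1
  -- unwind: `log ‖v t‖ ≤ log ‖v t₀‖ + 4Kρ`, then exponentiate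
  have hlog : Real.log ‖v t‖ ≤ Real.log ‖v t₀‖ + 4 * K * ρ := by
    have e1 : 2 * K * φ t ≤ 2 * K * ρ :=
      mul_le_mul_of_nonneg_left (abs_le.mp (hφle t ht)).2 (by positivity)
    have e2 : 2 * K * (-φ t₀) ≤ 2 * K * ρ :=
      mul_le_mul_of_nonneg_left (neg_le.mp (abs_le.mp (hφle t₀ ht₀)).1) (by positivity)
    linarith
  calc ‖v t‖ = Real.exp (Real.log ‖v t‖) := (Real.exp_log (hpos t ht)).symm
    _ ≤ Real.exp (Real.log ‖v t₀‖ + 4 * K * ρ) := Real.exp_le_exp.mpr hlog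
    _ = ‖v t₀‖ * Real.exp (4 * K * ρ) := by rw [Real.exp_add, Real.exp_log (hpos t₀ ht₀)]

end Summit.FinalStateConjecture.FinalStateConjecture.Theorems.PhotonSphereChannels.TameCensorshipUnwind

end
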